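import Summits.ValiantsHypothesis.ValiantsHypothesis.Theorems.DefinabilityGapRoundOne
import Summits.ValiantsHypothesis.ValiantsHypothesis.Theorems.DefinabilityGapBlockedTail
import Summits.ValiantsHypothesis.ValiantsHypothesis.Theorems.DefinabilityGapRepick
import HarnessLib

/-!
# Definability gap, ROAD P: the round-one state with room for EVERY curve (PLAN (d) v3, (H1))

`DefinabilityGapRoundOne.exists_roundOne` controls the blocked pivot rows of NON-hubs only.
With the MGF domination / Bernstein tail of `DefinabilityGapBlockedTail` the hub distinction
disappears: **`exists_roundOneAll`** — for all large `m`, every `T` with `#T ≤ 2q+1` and every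
pivot column `s₀` with `m Λ(s₀) ≤ 2#T(#T−1)` admit a row assignment `r` that
(1) obeys the row rule (`N = 32m`), (2) lies off the Phase-A bad set with the growing demand
`B₁`, (3) has `< 2p²·2#T(#T−1)/m + 1` collisions in column `s₀`, and
(4') leaves EVERY curve `c ∈ T` at least `m e^{−44}/4` admissible rows that are not blocked
(`s₀ ∈ freeCols`), i.e. a re-pick set of linear size — hubs included.
Constants: `2 pC · colLoad/#A ≤ 44` for `m ≥ 64` (`colLoad ≤ 2#T ≤ 8m²+10`, `#A ≥ m − kC`,
`pC ≤ 2/m`), deviation `t = m e^{−44}/4`, failure `≤ (4m²+5) e^{−e^{−88} m/96} < 1/8` eventually.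
-/

namespace Summit.ValiantsHypothesis.ValiantsHypothesis.Theorems.DefinabilityGapRoundOneAll

open Filter Topology Real Finset Literature.Probability.Moments
open Literature.Computability.AlgebraicComplexity Literature.Computability.MetaComplexity
open Summit.ValiantsHypothesis.ValiantsHypothesis.Theorems.DefinabilityGapAffineRung
open Summit.ValiantsHypothesis.ValiantsHypothesis.Theorems.DefinabilityGapPivotCertificate
open Summit.ValiantsHypothesis.ValiantsHypothesis.Theorems.DefinabilityGapPivotAdmissible
open Summit.ValiantsHypothesis.ValiantsHypothesis.Theorems.DefinabilityGapPivotPhaseA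
open Summit.ValiantsHypothesis.ValiantsHypothesis.Theorems.DefinabilityGapCrowdedFree
open Summit.ValiantsHypothesis.ValiantsHypothesis.Theorems.DefinabilityGapPivotColumn
open Summit.ValiantsHypothesis.ValiantsHypothesis.Theorems.DefinabilityGapAsymptotics
open Summit.ValiantsHypothesis.ValiantsHypothesis.Theorems.DefinabilityGapNumerics
open Summit.ValiantsHypothesis.ValiantsHypothesis.Theorems.DefinabilityGapPhaseAExists
open Summit.ValiantsHypothesis.ValiantsHypothesis.Theorems.DefinabilityGapPhaseABad
open Summit.ValiantsHypothesis.ValiantsHypothesis.Theorems.DefinabilityGapMovers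
open Summit.ValiantsHypothesis.ValiantsHypothesis.Theorems.DefinabilityGapBlockedRows
open Summit.ValiantsHypothesis.ValiantsHypothesis.Theorems.DefinabilityGapRoundOne
open Summit.ValiantsHypothesis.ValiantsHypothesis.Theorems.DefinabilityGapBlockedTail
open Summit.ValiantsHypothesis.ValiantsHypothesis.Theorems.DefinabilityGapRepick

/-! ## 1. Numerics of the all-curves blocked event -/

/-- The deviation `t_b = m e^{−44}/4`. [this file] -/
noncomputable def tb (m : ℕ) : ℝ := (m : ℝ) * exp (-44) / 4

/-- `0 < t_b` for `m ≥ 1`. [this file] -/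
theorem tb_pos {m : ℕ} (hm : 1 ≤ m) : 0 < tb m := by
  unfold tb
  have : (1 : ℝ) ≤ m := by exact_mod_cast hm
  positivity

/-- `t_b ≤ m`. [this file] -/
theorem tb_le (m : ℕ) : tb m ≤ m := by
  unfold tb
  have h1 : exp (-44 : ℝ) ≤ 1 := exp_le_one_iff.mpr (by norm_num)
  have hm : (0 : ℝ) ≤ m := Nat.cast_nonneg _
  nlinarith [exp_pos (-44 : ℝ)]

/-- `2 pC · colLoad / #A ≤ 44` in the form used: `2 · pC · (8m²+10) ≤ 44 (m − kC)` for `m ≥ 64`.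
[this file] -/
theorem exponent_le {m : ℕ} (hm : 64 ≤ m) :
    2 * pC m * (8 * ((m : ℝ) * m) + 10) ≤ 44 * ((m - kC m : ℕ) : ℝ) := by
  have hk : kC m < m := kC_lt (by omega)
  have hsub : (3 : ℝ) * m / 4 - 1 ≤ ((m - kC m : ℕ) : ℝ) := by
    have h1 : ((m - kC m : ℕ) : ℝ) = (m : ℝ) - (kC m : ℝ) := by
      rw [Nat.cast_sub hk.le]
    have h2 : (kC m : ℝ) ≤ (m : ℝ) / 4 + 1 := by
      unfold kC
      have : ((m / 4 : ℕ) : ℝ) ≤ (m : ℝ) / 4 := Nat.cast_div_le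
      push_cast
      linarith
    rw [h1]; linarith
  have hp := pC_le (m := m) (by omega)
  have hm' : (64 : ℝ) ≤ m := by exact_mod_cast hm
  have hm0 : (0 : ℝ) < m := by linarith
  have hp0 : 0 ≤ pC m := (pC_pos (m := m) (by omega)).le
  calc 2 * pC m * (8 * ((m : ℝ) * m) + 10) ≤ 2 * (2 / m) * (8 * ((m : ℝ) * m) + 10) := by
        gcongr
    _ = 32 * m + 40 / m := by field_simp; ring
    _ ≤ 32 * m + 1 := by
        have : 40 / (m : ℝ) ≤ 1 := by rw [div_le_one hm0]; linarith
        linarith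
    _ ≤ 44 * ((3 : ℝ) * m / 4 - 1) := by linarith
    _ ≤ 44 * ((m - kC m : ℕ) : ℝ) := by linarith

/-- The failure bound of the all-curves blocked event is eventually `< 1/8`. [this file] -/
theorem blockedAll_eventually : ∀ᶠ m : ℕ in atTop,
    (4 * (m : ℝ) ^ 2 + 5) * exp (-(exp (-88) / 96 * m)) < 1 / 8 := by
  have ha : (0 : ℝ) < exp (-88) / 96 := by positivity
  filter_upwards [eventually_ge_atTop 3,
    eventually_const_mul_pow_mul_exp_neg_lt 2 ha 5 (show (0 : ℝ) < 1 / 8 by norm_num)]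
    with m hm h
  have hm3 : (3 : ℝ) ≤ m := by exact_mod_cast hm
  have h5 : 4 * (m : ℝ) ^ 2 + 5 ≤ 5 * (m : ℝ) ^ 2 := by nlinarith
  exact lt_of_le_of_lt (mul_le_mul_of_nonneg_right h5 (exp_pos _).le) h

/-- Eventually `1 + e^{−44} ≤ t_b` (so that the room is at least `m e^{−44}/4`). [this file] -/
theorem tb_eventually : ∀ᶠ m : ℕ in atTop, 1 + exp (-44) + tb m ≤ (m : ℝ) * exp (-44) / 2 := by
  have h : Tendsto (fun m : ℕ => (m : ℝ) * exp (-44) / 4) atTop atTop :=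
    (tendsto_natCast_atTop_atTop.atTop_mul_const (exp_pos (-44))).atTop_div_const
      (by norm_num)
  filter_upwards [h.eventually_ge_atTop (1 + exp (-44))] with m hm
  unfold tb
  linarith

/-! ## 2. The round-one state, every curve with room -/

open scoped Classical in
/-- **THE ROUND-ONE STATE WITH ROOM FOR EVERY CURVE.** [this file] -/
theorem exists_roundOneAll : ∃ m₀ : ℕ, ∀ m : ℕ, m₀ ≤ m →
    ∀ T : Finset (Fin 3 → Fin (qOf m)), T.card ≤ 2 * qOf m + 1 → ∀ s₀ : Fin m,
      m * ∑ c ∈ T, colLoad T c s₀ ≤ 2 * (T.card * (T.card - 1)) →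
      ∃ r : (Fin 3 → Fin (qOf m)) → Fin m,
        (∀ c, r c ∉ heavyRows T c (NC m)) ∧
        r ∉ phaseABad T (MC m) (NC m) (m / 2) (pC m) (tC m) (B₁ m : ℝ) ∧
        ((collCount T s₀ r : ℕ) : ℝ) <
          2 * (pC m ^ 2 * (2 * ((T.card : ℝ) * (T.card - 1 : ℕ)) / m)) + 1 ∧
        ∀ c ∈ T, (m : ℝ) * exp (-44) / 4 ≤
          (((heavyRows T c (NC m))ᶜ \ blockedRows T c r s₀).card : ℝ) := by
  obtain ⟨m₀, hm₀⟩ := Filter.eventually_atTop.mp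
    ((eventually_ge_atTop 4800).and (eventually_two_le_sC.and
      ((smallExpr_eventually_lt (show (0 : ℝ) < 1 / 4 by norm_num)).and
        (blockedAll_eventually.and tb_eventually))))
  refine ⟨m₀, fun m hm T hT s₀ hs₀ => ?_⟩
  obtain ⟨hm4800, hs, hsmall, hblk, htb⟩ := hm₀ m hm
  have hm0 : 0 < m := by omega
  have hm0' : (0 : ℝ) < m := by exact_mod_cast hm0
  have hT2 : 2 * T.card ≤ 2 * (2 * qOf m + 1) := by omega
  have hTc8 : 2 * (T.card : ℝ) ≤ 8 * ((m : ℝ) * m) + 10 := by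
    have h := card_bound m
    have : ((2 * T.card : ℕ) : ℝ) ≤ ((8 * (m * m) + 10 : ℕ) : ℝ) := by exact_mod_cast hT2.trans h
    push_cast at this
    linarith
  have hTc : (T.card : ℝ) ≤ 4 * (m : ℝ) ^ 2 + 5 := by nlinarith
  have hk : 2 * T.card ≤ NC m * kC m := hT2.trans (hk_holds (by omega))
  have hkm : kC m < m := kC_lt (by omega)
  -- the admissible sets and their weights
  set A : (Fin 3 → Fin (qOf m)) → Finset (Fin m) := fun c => (heavyRows T c (NC m))ᶜ with hAdef
  have hcardA : ∀ c, m - kC m ≤ (A c).card := fun c =>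
    le_card_compl_heavyRows T c hk (by unfold NC; omega)
  have hA : ∀ c, (A c).Nonempty := fun c => Finset.card_pos.mp (by have := hcardA c; omega)
  have hp0 : 0 < pC m := pC_pos (by omega)
  have hAp : ∀ c, 1 / ((A c).card : ℝ) ≤ pC m := fun c => by
    unfold pC
    exact one_div_le_one_div_of_le (by exact_mod_cast (show 0 < m - kC m by omega))
      (by exact_mod_cast hcardA c)
  have hw : ∀ c a, 0 ≤ admWeight A c a := admWeight_nonneg A
  have hw1 : ∀ c, ∑ a, admWeight A c a = 1 := sum_admWeight A hA
  have hwp : ∀ c a, admWeight A c a ≤ pC m := fun c a => (admWeight_le A c a).trans (hAp c)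
  -- the collision event
  set Q : ℝ := pC m ^ 2 * (2 * ((T.card : ℝ) * (T.card - 1 : ℕ)) / m) with hQ
  have hQ0 : 0 ≤ Q := by rw [hQ]; positivity
  set E₁ := (Finset.univ : Finset ((Fin 3 → Fin (qOf m)) → Fin m)).filter
    (fun r => 2 * Q + 1 ≤ ((collCount T s₀ r : ℕ) : ℝ)) with hE₁
  have hW₁ : ∑ r ∈ E₁, prodWeight (admWeight A) r ≤ 1 / 2 := by
    have h := weight_manyCollisions_le hw hw1 hwp T s₀ (show (0 : ℝ) < 2 * Q + 1 by positivity)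
    have hload := sq_mul_load_le (p := pC m) T hm0 hs₀
    calc _ ≤ pC m ^ 2 * (∑ c ∈ T, (colLoad T c s₀ : ℝ)) / (2 * Q + 1) := h
      _ ≤ Q / (2 * Q + 1) := div_le_div_of_nonneg_right hload (by positivity)
      _ ≤ 1 / 2 := div_two_mul_add_one_le hQ0
  -- the all-curves blocked event
  set μ : (Fin 3 → Fin (qOf m)) → ℝ := fun c =>
    (A c).card - (A c).card * exp (-(2 * pC m * colLoad T c s₀ / (A c).card)) + 1 with hμdef
  have hμ0 : ∀ c, 0 < μ c := fun c => by
    simp only [hμdef]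
    have h1 : exp (-(2 * pC m * colLoad T c s₀ / (A c).card)) ≤ 1 :=
      exp_le_one_iff.mpr (by
        have : (0 : ℝ) ≤ 2 * pC m * colLoad T c s₀ / (A c).card := by positivity
        linarith)
    have hA0 : (0 : ℝ) ≤ (A c).card := Nat.cast_nonneg _
    nlinarith
  set E₃ := T.biUnion (fun c => (Finset.univ : Finset ((Fin 3 → Fin (qOf m)) → Fin m)).filter
    (fun r => μ c + tb m ≤ ((blockedRows T c r s₀ ∩ A c).card : ℝ))) with hE₃
  have htb0 : 0 < tb m := tb_pos (by omega)
  have hW₃ : ∑ r ∈ E₃, prodWeight (admWeight A) r ≤ 1 / 8 := by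
    refine (weight_biUnion_le T _ hw).trans ?_
    have hterm : ∀ c ∈ T, ∑ r ∈ (Finset.univ : Finset ((Fin 3 → Fin (qOf m)) → Fin m)).filter
        (fun r => μ c + tb m ≤ ((blockedRows T c r s₀ ∩ A c).card : ℝ)),
          prodWeight (admWeight A) r ≤ exp (-(exp (-88) / 96 * m)) := by
      intro c _
      have hμle : ∑ ρ ∈ A c, (1 - ∏ c' ∈ coCurves T c (ρ, s₀), (1 - admWeight A c' ρ)) ≤ μ c :=
        (sum_one_sub_prod_le hp0.le (pC_le_half (m := m) (by omega)) hwp T c s₀ (hA c)).trans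
          (by simp only [hμdef]; linarith)
      refine (weight_manyBlockedRows_le hw hw1 T c s₀ (A c) (hμ0 c) hμle htb0).trans
        (exp_le_exp.2 ?_)
      -- `μ c ≤ m + 1`, `tb ≤ m`: the exponent is at most `−tb²/(6m) ≤ −e^{−88} m / 96`
      have hAm : ((A c).card : ℝ) ≤ m := by
        have : (A c).card ≤ m := (Finset.card_le_univ _).trans (by simp)
        exact_mod_cast this
      have hμm : μ c ≤ m + 1 := by
        simp only [hμdef]
        have : 0 ≤ ((A c).card : ℝ) * exp (-(2 * pC m * colLoad T c s₀ / (A c).card)) := by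
          positivity
        linarith
      have htbm := tb_le m
      have hm1 : (1 : ℝ) ≤ m := by exact_mod_cast hm0
      have hden : 2 * (μ c + tb m / 3) ≤ 6 * m := by linarith
      have hden0 : 0 < 2 * (μ c + tb m / 3) := by have := hμ0 c; positivity
      have hsq : tb m ^ 2 = exp (-88) / 16 * (m : ℝ) ^ 2 := by
        unfold tb
        have : exp (-88 : ℝ) = exp (-44) * exp (-44) := by rw [← exp_add]; norm_num
        rw [this]; ring
      rw [neg_le_neg_iff]
      calc exp (-88) / 96 * (m : ℝ) = exp (-88) / 16 * (m : ℝ) ^ 2 / (6 * m) := by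
            field_simp; ring
        _ ≤ tb m ^ 2 / (2 * (μ c + tb m / 3)) := by
            rw [← hsq]
            exact div_le_div_of_nonneg_left (by positivity) hden0 hden
    calc ∑ c ∈ T, ∑ r ∈ (Finset.univ : Finset ((Fin 3 → Fin (qOf m)) → Fin m)).filter
          (fun r => μ c + tb m ≤ ((blockedRows T c r s₀ ∩ A c).card : ℝ)),
            prodWeight (admWeight A) r
        ≤ ∑ c ∈ T, exp (-(exp (-88) / 96 * m)) := sum_le_sum hterm
      _ = (T.card : ℝ) * exp (-(exp (-88) / 96 * m)) := by rw [sum_const, nsmul_eq_mul]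
      _ ≤ (4 * (m : ℝ) ^ 2 + 5) * exp (-(exp (-88) / 96 * m)) :=
          mul_le_mul_of_nonneg_right hTc (exp_pos _).le
      _ ≤ 1 / 8 := hblk.le
  have hE : ∑ r ∈ E₁ ∪ E₃, prodWeight (admWeight A) r ≤ 1 / 2 + 1 / 8 :=
    (weight_union_le E₁ E₃ (prodWeight_nonneg hw)).trans (add_le_add hW₁ hW₃)
  have hsm := hsmall T.card (Nat.cast_nonneg _) hTc
  unfold smallExpr at hsm
  obtain ⟨r, hr, hrE, hadm⟩ := exists_adm_not_mem_union T A hA hp0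
    (pC_le_half (m := m) (by omega)) hAp (MC_pos (m := m) (by omega)) hm0
    (tC_pos (m := m) (by omega)) (N := NC m) (by unfold NC; omega) hs (sC_le m)
    (tpC_pos (m := m) (by omega)) (hB_B₁ (m := m) (by omega)) (E₁ ∪ E₃) (by linarith)
  refine ⟨r, fun c => ?_, hr, ?_, ?_⟩
  · have := hadm c
    rw [hAdef] at this
    exact Finset.mem_compl.mp this
  · by_contra hge
    exact hrE (Finset.mem_union_left _
      (Finset.mem_filter.mpr ⟨Finset.mem_univ _, not_lt.mp hge⟩))
  · intro c hc
    have hlt : ((blockedRows T c r s₀ ∩ A c).card : ℝ) < μ c + tb m := by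
      by_contra hge
      exact hrE (Finset.mem_union_right _ (Finset.mem_biUnion.mpr
        ⟨c, hc, Finset.mem_filter.mpr ⟨Finset.mem_univ _, not_lt.mp hge⟩⟩))
    -- room = #A − #(blocked ∩ A) > #A e^{−x} − 1 − tb ≥ (m − kC) e^{−44} − 1 − tb ≥ m e^{−44}/4
    have hsd : (((A c) \ blockedRows T c r s₀).card : ℝ) =
        (A c).card - ((blockedRows T c r s₀ ∩ A c).card : ℝ) := by
      have h := Finset.card_sdiff_add_card_inter (A c) (blockedRows T c r s₀)
      rw [Finset.inter_comm] at h
      have : (((A c) \ blockedRows T c r s₀).card : ℝ) + ((blockedRows T c r s₀ ∩ A c).card : ℝ)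
          = (A c).card := by exact_mod_cast h
      linarith
    have hAge : ((m - kC m : ℕ) : ℝ) ≤ (A c).card := by exact_mod_cast hcardA c
    have hApos : (0 : ℝ) < (A c).card := by
      have : (16 : ℝ) ≤ ((m - kC m : ℕ) : ℝ) := by exact_mod_cast sub_kC_ge (m := m) (by omega)
      linarith
    have hx : 2 * pC m * colLoad T c s₀ / (A c).card ≤ 44 := by
      rw [div_le_iff₀ hApos]
      have hcl : (colLoad T c s₀ : ℝ) ≤ 8 * ((m : ℝ) * m) + 10 := by
        have h1 := colLoad_le T c s₀
        have h2 : ((T.erase c).card : ℝ) ≤ T.card := by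
          exact_mod_cast Finset.card_erase_le
        linarith
      calc 2 * pC m * (colLoad T c s₀ : ℝ) ≤ 2 * pC m * (8 * ((m : ℝ) * m) + 10) := by
            have : 0 ≤ 2 * pC m := by positivity
            exact mul_le_mul_of_nonneg_left hcl this
        _ ≤ 44 * ((m - kC m : ℕ) : ℝ) := exponent_le (by omega)
        _ ≤ 44 * (A c).card := by linarith
    have hexp : exp (-44) ≤ exp (-(2 * pC m * colLoad T c s₀ / (A c).card)) :=
      exp_le_exp.2 (by linarith)
    have hsub : (3 : ℝ) * m / 4 - 1 ≤ ((m - kC m : ℕ) : ℝ) := by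
      have h1 : ((m - kC m : ℕ) : ℝ) = (m : ℝ) - (kC m : ℝ) := by rw [Nat.cast_sub hkm.le]
      have h2 : (kC m : ℝ) ≤ (m : ℝ) / 4 + 1 := by
        unfold kC
        have : ((m / 4 : ℕ) : ℝ) ≤ (m : ℝ) / 4 := Nat.cast_div_le
        push_cast
        linarith
      rw [h1]; linarith
    have hroom : ((A c).card : ℝ) * exp (-44) - 1 - tb m ≤
        (((A c) \ blockedRows T c r s₀).card : ℝ) := by
      rw [hsd]
      simp only [hμdef] at hlt
      have : ((A c).card : ℝ) * exp (-44) ≤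
          (A c).card * exp (-(2 * pC m * colLoad T c s₀ / (A c).card)) :=
        mul_le_mul_of_nonneg_left hexp hApos.le
      linarith
    have hfin : (m : ℝ) * exp (-44) / 4 ≤ ((A c).card : ℝ) * exp (-44) - 1 - tb m := by
      have he0 := exp_pos (-44 : ℝ)
      have h34 : ((3 : ℝ) * m / 4 - 1) * exp (-44) ≤ ((A c).card : ℝ) * exp (-44) :=
        mul_le_mul_of_nonneg_right (hsub.trans hAge) he0.le
      nlinarith
    rw [hAdef] at hroom
    exact hfin.trans (by rw [hAdef]; exact hroom)

end Summit.ValiantsHypothesis.ValiantsHypothesis.Theorems.DefinabilityGapRoundOneAll
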